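import Literature.AlgebraicGeometry.HodgeTheory.FermatSurfaceHodgeCharacterNineDvdOdd
import Literature.AlgebraicGeometry.Shioda1982.StandardQuadrupleLetter
import HarnessLib

/-!
# Theorem C at the odd levels `m` with `9 ∣ m` and a good prime: standard quadruples and the letter of `(𝔅²ₘ)` (ii)

Topic `Literature/AlgebraicGeometry/Shioda1982`. THEOREMS only (no definition, no named fact, no `sorry`).

`HodgeTheory/FermatSurfaceHodgeCharacterNineDvdOdd` proves [Aoki1983, Thm. C] at the ODD levels `m` with `9 ∣ m` and a
good prime (`p ∣ m` with `p ≥ 11`, or `p ∈ {5, 7}` with `p² ∣ m`), in function form (`standard_of_isHodge_nine_dvd_odd`: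
a primitive Hodge character of length `4` is decomposable or of type C `(x, x + m/3, x + 2m/3, -3x)`). This file rewrites
that in the two other vocabularies of the tree (as `StandardQuadrupleThriceCoprime` does at `m = 3m''`, `3 ∤ m''`):
* **`isStandardQuadruple_of_nine_dvd_odd`**: the multiset of values of a pair-free primitive Hodge character is a standard
  quadruple `t·L₃` of [MeyerNeutsch1981Fermatquadrupel, (15) p. 53] (`IsStandardQuadruple`, `ExceptionalQuadruples.lean`),
  `K = m/3`;
* **`not_isExceptionalQuadruple_nine_dvd_odd`**: `Δ(m) = 0` — no Ausnahmequadrupel at these levels (the multiset form, the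
  shape of the kernel sweeps `not_isExceptionalQuadruple_N`);
* **`thmB2m_standard_nine_dvd_odd`**: the letter of the tree's named fact `AokiShioda1983_thmB2m_standard`
  (`HodgeTheory/FermatSurfaceHodgeCharacterStructure`) at these levels: every indecomposable primitive Hodge character is a
  permutation of `γⱼ = (j, d+j, 2d+j, −3j)`, `d = m/3` (via `letter_of_isStandardQuadruple`, `StandardQuadrupleLetter.lean`).

HONEST FRAMING (cell `pub-hfermat`): explicit algebraic cycles for specific Hodge classes on Fermat/Delsarte varieties;
residual open instances listed; no claim on general Hodge. (Surface classes are algebraic by Lefschetz (1,1); this file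
restates a proved case of a structure theorem for `𝔅²ₘ`.)

## References
* [Aoki1983] N. Aoki, Math. Ann. 266 (1983) 23–54, Thm. C and §9.
* [AokiShioda1983] N. Aoki, T. Shioda, Progr. Math. 35 (1983) 1–12, §2 Thm (𝔅²ₘ) (ii) c).
* [MeyerNeutsch1981Fermatquadrupel] W. Meyer, W. Neutsch, Math. Ann. 256 (1981) 51–62, (15) p. 53, Tabelle 1 p. 54.
-/

namespace Literature.AlgebraicGeometry.Shioda1982

open Finset Multiset Literature.AlgebraicGeometry.HodgeTheory Literature.AlgebraicGeometry.HodgeTheory.FermatCharacter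

section NineDvdOdd

variable {m : ℕ} [NeZero m]

omit [NeZero m] in
/-- The multiset of values of a `4`-tuple, listed along four pairwise distinct indices. [folklore] -/
private theorem univ_val_map_eq_of_distinct₉ {X : Type*} (α : Fin 4 → X) (a b c d : Fin 4) (hab : a ≠ b)
    (hac : a ≠ c) (had : a ≠ d) (hbc : b ≠ c) (hbd : b ≠ d) (hcd : c ≠ d) :
    univ.val.map α = {α a, α b, α c, α d} := by
  classical
  have hc4 : #({a, b, c, d} : Finset (Fin 4)) = 4 := by
    rw [Finset.card_insert_of_notMem (by simp [hab, hac, had]),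
      Finset.card_insert_of_notMem (by simp [hbc, hbd]), Finset.card_pair hcd]
  have huniv : (univ : Finset (Fin 4)) = {a, b, c, d} :=
    (Finset.eq_univ_of_card _ (by rw [hc4]; simp)).symm
  rw [huniv, Finset.insert_val, Multiset.ndinsert_of_notMem (by simp [hab, hac, had]), Finset.insert_val,
    Multiset.ndinsert_of_notMem (by simp [hbc, hbd]), Finset.insert_val,
    Multiset.ndinsert_of_notMem (by simp [hcd]), Finset.singleton_val]
  simp only [Multiset.insert_eq_cons, Multiset.map_cons, Multiset.map_singleton]

/-- `t · (m/3) ∈ {m/3, 2·(m/3)}` in `ℤ/m` for a unit `t`, `3 ∣ m` (`t ≢ 0 (mod 3)`, `3 · (m/3) = 0`). [folklore] -/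
private theorem unit_mul_third₉ (h3 : 3 ∣ m) (t : (ZMod m)ˣ) :
    (t : ZMod m) * ((m / 3 : ℕ) : ZMod m) = ((m / 3 : ℕ) : ZMod m) ∨
      (t : ZMod m) * ((m / 3 : ℕ) : ZMod m) = 2 * ((m / 3 : ℕ) : ZMod m) := by
  have hcop : Nat.Coprime (t : ZMod m).val m := ZMod.val_coe_unit_coprime t
  have hK3 : (3 : ZMod m) * ((m / 3 : ℕ) : ZMod m) = 0 := by
    rw [show (3 : ZMod m) = ((3 : ℕ) : ZMod m) by norm_cast, ← Nat.cast_mul, ZMod.natCast_eq_zero_iff,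
      Nat.mul_div_cancel' h3]
  have hr : (t : ZMod m).val % 3 = 1 ∨ (t : ZMod m).val % 3 = 2 := by
    have hne : (t : ZMod m).val % 3 ≠ 0 := fun h ↦ by
      have h0 : 3 ∣ (t : ZMod m).val := Nat.dvd_of_mod_eq_zero h
      have h31 : 3 ∣ Nat.gcd (t : ZMod m).val m := Nat.dvd_gcd h0 h3
      rw [Nat.Coprime.gcd_eq_one hcop] at h31
      exact absurd (Nat.le_of_dvd one_pos h31) (by norm_num)
    omega
  have key : (t : ZMod m) * ((m / 3 : ℕ) : ZMod m) =
      (((t : ZMod m).val % 3 : ℕ) : ZMod m) * ((m / 3 : ℕ) : ZMod m) := by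
    conv_lhs => rw [← ZMod.natCast_zmod_val (t : ZMod m), ← Nat.div_add_mod (t : ZMod m).val 3]
    push_cast
    linear_combination (((t : ZMod m).val / 3 : ℕ) : ZMod m) * hK3
  rcases hr with hr | hr
  · left; rw [key, hr]; push_cast; ring
  · right; rw [key, hr]; push_cast; ring

/-- **No exceptional quadruple at the odd levels `m` with `9 ∣ m` and a good prime:** the multiset of values of a pair-free
primitive Hodge character of length `4` is a standard quadruple — a unit multiple of `L₃ = (1, K+1, 2K+1, 3K−3)`, `K = m/3`
(type C, `t = x`; `x·K ∈ {K, 2K}`) (`standard_of_isHodge_nine_dvd_odd`).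
[cite: Aoki1983, Thm. C] [cite: MeyerNeutsch1981Fermatquadrupel, (15) p. 53 (Standardquadrupel)] -/
theorem isStandardQuadruple_of_nine_dvd_odd (hodd : Odd m) (h9 : 9 ∣ m) {p : ℕ} (hp : p.Prime) (hpm : p ∣ m)
    (hbig : 11 ≤ p ∨ (5 ≤ p ∧ p ^ 2 ∣ m)) {α : Fin 4 → ZMod m} (hα : IsHodge α)
    (hind : ∀ i j : Fin 4, i ≠ j → α i + α j ≠ 0) (hprim : ∀ g : ℕ, (∀ i, g ∣ (α i).val) → g = 1) :
    IsStandardQuadruple m (univ.val.map α) := by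
  classical
  have h3 : 3 ∣ m := dvd_trans (by norm_num) h9
  have h3n : (3 : ZMod m) * ((m / 3 : ℕ) : ZMod m) = 0 := by
    rw [show (3 : ZMod m) = ((3 : ℕ) : ZMod m) by norm_cast, ← Nat.cast_mul, ZMod.natCast_eq_zero_iff,
      Nat.mul_div_cancel' h3]
  rcases standard_of_isHodge_nine_dvd_odd hodd h9 hp hpm hbig hα hprim with
    ⟨i, j, hij, h⟩ | ⟨i₀, j₁, j₂, j₃, h01, h02, h03, h12, h13', h23, hu, e1, e2, e3⟩
  · exact absurd h (hind i j hij)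
  · -- type C: `{x, x + K, x + 2K, -3x} = x · L₃`, `K = m/3`
    refine ⟨hu.unit, Or.inr ⟨h3, ?_⟩⟩
    rcases unit_mul_third₉ h3 hu.unit with hxn | hxn <;> rw [IsUnit.unit_spec] at hxn
    · rw [univ_val_map_eq_of_distinct₉ α i₀ j₁ j₂ j₃ h01 h02 h03 h12 h13' h23, e1, e2, e3, stdThree]
      simp only [Multiset.insert_eq_cons, Multiset.map_cons, Multiset.map_singleton, IsUnit.unit_spec,
        mul_one]
      rw [show α i₀ * (((m / 3 : ℕ) : ZMod m) + 1) = α i₀ + ((m / 3 : ℕ) : ZMod m) by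
            rw [mul_add, hxn, mul_one, add_comm],
        show α i₀ * (2 * ((m / 3 : ℕ) : ZMod m) + 1) = α i₀ + 2 * ((m / 3 : ℕ) : ZMod m) by
            linear_combination 2 * hxn,
        show α i₀ * (3 * ((m / 3 : ℕ) : ZMod m) - 3) = -3 * α i₀ by linear_combination 3 * hxn + h3n]
    · -- `x ≡ 2 (mod 3)`: the middle entries are exchanged
      rw [univ_val_map_eq_of_distinct₉ α i₀ j₂ j₁ j₃ h02 h01 h03 h12.symm h23 h13', e1, e2, e3, stdThree]
      simp only [Multiset.insert_eq_cons, Multiset.map_cons, Multiset.map_singleton, IsUnit.unit_spec,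
        mul_one]
      rw [show α i₀ * (((m / 3 : ℕ) : ZMod m) + 1) = α i₀ + 2 * ((m / 3 : ℕ) : ZMod m) by
            rw [mul_add, hxn, mul_one, add_comm],
        show α i₀ * (2 * ((m / 3 : ℕ) : ZMod m) + 1) = α i₀ + ((m / 3 : ℕ) : ZMod m) by
            linear_combination 2 * hxn + h3n,
        show α i₀ * (3 * ((m / 3 : ℕ) : ZMod m) - 3) = -3 * α i₀ by linear_combination 3 * hxn + 2 * h3n]

/-! ### The multiset form: no exceptional quadruple at these levels -/

omit [NeZero m] in
/-- Divisibility of Meyer–Neutsch's `gcd(a₁, …, a_k, m)` (a right fold of `Nat.gcd`). [folklore] -/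
private theorem dvd_foldr_gcd₉ {d b : ℕ} {l : Multiset ℕ} (hb : d ∣ b) (hl : ∀ v ∈ l, d ∣ v) :
    d ∣ l.foldr Nat.gcd b := by
  induction l using Multiset.induction_on with
  | empty => simpa using hb
  | cons a l ih =>
    rw [Multiset.foldr_cons]
    exact Nat.dvd_gcd (hl a (Multiset.mem_cons_self a l)) (ih fun v hv ↦ hl v (Multiset.mem_cons_of_mem hv))

omit [NeZero m] in
/-- A `4`-tuple whose multiset of values has no pair `a, -a` (as two members) is indecomposable. [folklore] -/
private theorem indecomposable_of_not_hasPair₉ {α : Fin 4 → ZMod m} (h : ¬ HasPair (univ.val.map α)) :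
    ∀ i j : Fin 4, i ≠ j → α i + α j ≠ 0 := by
  classical
  intro i j hij hsum
  apply h
  refine ⟨α i, Multiset.mem_map.mpr ⟨i, Finset.mem_univ_val i, rfl⟩, ?_⟩
  have hneg : -α i = α j := by linear_combination (-1 : ZMod m) * hsum
  rw [hneg]
  by_cases he : α j = α i
  · have h2 : 2 ≤ Multiset.count (α i) (univ.val.map α) := by
      rw [count_univ_val_map]
      exact Finset.one_lt_card.mpr ⟨i, by simp, j, by simp [he], hij⟩
    rw [he, ← Multiset.count_pos, Multiset.count_erase_self]
    omega
  · exact (Multiset.mem_erase_of_ne he).mpr (Multiset.mem_map.mpr ⟨j, Finset.mem_univ_val j, rfl⟩)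

/-- **At an ODD level, Meyer–Neutsch primitivity `gcd(a₁, …, a₄, m) = 1` of the multiset of values of a Hodge character gives
`GCD(⟨aᵢ⟩) = 1`** in the letter of the named fact: a common divisor `g` of the `⟨aᵢ⟩` divides `∑ ⟨aᵢ⟩ = 2m` and is prime to
`m`, so `g ∣ 2`; and `g = 2` is impossible, since for the unit `u = 2⁻¹` one would get `⟨u aᵢ⟩ = ⟨aᵢ⟩/2` and
`∑ ⟨u aᵢ⟩ = m ≠ 2m`. [cite: MeyerNeutsch1981Fermatquadrupel, (9)–(10) p. 52] -/
private theorem forall_dvd_of_isPrimitive_odd₉ (hm : Odd m) {α : Fin 4 → ZMod m} (hα : IsHodge α)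
    (hp : IsPrimitive m (univ.val.map α)) : ∀ g : ℕ, (∀ i, g ∣ (α i).val) → g = 1 := by
  intro g hg
  have hm0 : m ≠ 0 := NeZero.ne m
  -- `∑ ⟨aᵢ⟩ = 2m`
  have hsum : ∑ i, (α i).val = 2 * m := by
    have h1 := hα.2 1
    simp only [Units.val_one, one_mul] at h1
    change 2 * ∑ i, (α i).val = m * 4 at h1
    omega
  have hg4 : g ∣ 2 * m := hsum ▸ Finset.dvd_sum fun i _ ↦ hg i
  -- `gcd(g, m) = 1`
  have hcop : Nat.Coprime g m := by
    have hd : Nat.gcd g m ∣ ((univ.val.map α).map ZMod.val).foldr Nat.gcd m := by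
      refine dvd_foldr_gcd₉ (Nat.gcd_dvd_right _ _) fun v hv ↦ ?_
      obtain ⟨a, ha, rfl⟩ := Multiset.mem_map.mp hv
      obtain ⟨i, -, rfl⟩ := Multiset.mem_map.mp ha
      exact (Nat.gcd_dvd_left _ _).trans (hg i)
    unfold IsPrimitive at hp
    rw [hp] at hd
    exact Nat.dvd_one.mp hd
  have hg2 : g ∣ 2 := hcop.dvd_of_dvd_mul_right hg4
  have hg0 : g ≠ 0 := fun h ↦ by rw [h] at hg2; exact absurd (Nat.eq_zero_of_zero_dvd hg2) two_ne_zero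
  have hgle : g ≤ 2 := Nat.le_of_dvd two_pos hg2
  interval_cases g
  · exact absurd rfl hg0
  · rfl
  · -- all `⟨aᵢ⟩` even: halve with the unit `2⁻¹`
    exfalso
    have h2u : IsUnit (2 : ZMod m) := by
      rw [show (2 : ZMod m) = ((2 : ℕ) : ZMod m) by norm_cast, ZMod.isUnit_iff_coprime]
      exact Nat.coprime_two_left.mpr hm
    set u : (ZMod m)ˣ := h2u.unit⁻¹ with hu
    have h2inv : (2 : ZMod m) * (u : ZMod m) = 1 := by rw [hu]; exact h2u.mul_val_inv
    -- `⟨u aᵢ⟩ = ⟨aᵢ⟩ / 2`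
    have hhalf : ∀ i, ((u : ZMod m) * α i).val = (α i).val / 2 := by
      intro i
      obtain ⟨k, hk⟩ := hg i
      have hk' : (α i).val / 2 = k := by rw [hk]; simp
      have hklt : k < m := by
        have := ZMod.val_lt (α i)
        omega
      have e : (u : ZMod m) * α i = (k : ZMod m) := by
        have : α i = ((2 * k : ℕ) : ZMod m) := by rw [← hk, ZMod.natCast_zmod_val]
        rw [this, Nat.cast_mul, Nat.cast_ofNat, ← mul_assoc, mul_comm (u : ZMod m), h2inv, one_mul]
      rw [e, ZMod.val_natCast, Nat.mod_eq_of_lt hklt, hk']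
    have hu2 := hα.2 u
    unfold normSum at hu2
    simp only [hhalf] at hu2
    -- `∑ ⟨aᵢ⟩/2 = m`, so `2m = 4m`
    have hdiv : ∑ i, (α i).val / 2 = m := by
      have h2 : ∀ i, 2 * ((α i).val / 2) = (α i).val := fun i ↦ Nat.mul_div_cancel' (hg i)
      have : 2 * ∑ i, (α i).val / 2 = 2 * m := by
        rw [Finset.mul_sum, Finset.sum_congr rfl fun i _ ↦ h2 i, hsum]
      omega
    rw [hdiv] at hu2
    omega

/-- **`Δ(m) = 0` for `m` odd, `9 ∣ m` with a good prime: there is NO exceptional quadruple (Ausnahmequadrupel) at these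
levels** — every Hodge `4`-multiset without a pair `a, -a` and with `gcd(a₁, …, a₄, m) = 1` is a unit multiple of `L₃`
([Aoki1983, Thm. C] at these levels, in the vocabulary of [MeyerNeutsch1981Fermatquadrupel] / [Shioda1982PicardFermat, Prop. 4]).
[cite: Aoki1983, Thm. C] [cite: MeyerNeutsch1981Fermatquadrupel, p. 53 (Standard- und Ausnahmequadrupel)] -/
theorem not_isExceptionalQuadruple_nine_dvd_odd (hodd : Odd m) (h9 : 9 ∣ m) {p : ℕ} (hp : p.Prime) (hpm : p ∣ m)
    (hbig : 11 ≤ p ∨ (5 ≤ p ∧ p ^ 2 ∣ m)) (s : Multiset (ZMod m)) : ¬ IsExceptionalQuadruple m s := by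
  rintro ⟨h4, hs, hnp, hprim, hns⟩
  obtain ⟨r, α, rfl⟩ := exists_eq_univ_val_map s
  have hr : r = 4 := by rw [card_univ_val_map] at h4; exact h4
  subst hr
  have hα : IsHodge α := (isHodge_iff_isHodgeMultiset α).2 hs
  exact hns (isStandardQuadruple_of_nine_dvd_odd hodd h9 hp hpm hbig hα (indecomposable_of_not_hasPair₉ hnp)
    (forall_dvd_of_isPrimitive_odd₉ hodd hα hprim))

/-- **Aoki–Shioda 1983, Theorem `(𝔅²ₘ)` (ii) at the odd levels `m` with `9 ∣ m` and a good prime, in the letter of the tree's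
named fact `Literature.AlgebraicGeometry.HodgeTheory.AokiShioda1983_thmB2m_standard`:** every indecomposable primitive Hodge
character `α` of length `4` and level `m` is, after a permutation of the coordinates, c) `(j, d + j, 2d + j, −3j)` with
`m = 3d`, `1 ≤ j < d`, `(j, d) = 1`, `6j ≠ m`; alternatives a), b) (`m = 2d`) do not occur. This is the body of that fact at
these `m` (for all such `m`, not only `m > 180`): [Aoki1983, Thm. C] there (`isStandardQuadruple_of_nine_dvd_odd`) and the
generic bridge `letter_of_isStandardQuadruple`. [cite: AokiShioda1983, §2 Theorem (𝔅²ₘ) (ii) c), p. 3] [cite: Aoki1983, Thm. C] -/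
theorem thmB2m_standard_nine_dvd_odd (hodd : Odd m) (h9 : 9 ∣ m) {p : ℕ} (hp : p.Prime) (hpm : p ∣ m)
    (hbig : 11 ≤ p ∨ (5 ≤ p ∧ p ^ 2 ∣ m)) (α : Fin 4 → ZMod m) (hα : IsHodge α)
    (hind : ∀ i j : Fin 4, i ≠ j → α i + α j ≠ 0) (hprim : ∀ g : ℕ, (∀ i, g ∣ (α i).val) → g = 1) :
    ∃ σ : Equiv.Perm (Fin 4),
      (∃ d i : ℕ, m = 2 * d ∧ 1 ≤ i ∧ i < d ∧ Nat.Coprime i d ∧ 4 * i ≠ m ∧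
          ∀ k, α (σ k) = ![(i : ZMod m), (d : ZMod m) + i, -(2 * (i : ZMod m)), (d : ZMod m)] k) ∨
      (∃ d i : ℕ, m = 2 * d ∧ 1 ≤ i ∧ i < d ∧ Nat.Coprime i d ∧ 3 * i ≠ m ∧ 4 * i ≠ m ∧ 6 * i ≠ m ∧
          ∀ k, α (σ k) = ![(i : ZMod m), (d : ZMod m) + i, (d : ZMod m) + 2 * i, -(4 * (i : ZMod m))] k) ∨
      (∃ d j : ℕ, m = 3 * d ∧ 1 ≤ j ∧ j < d ∧ Nat.Coprime j d ∧ 6 * j ≠ m ∧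
          ∀ k, α (σ k) = ![(j : ZMod m), (d : ZMod m) + j, 2 * (d : ZMod m) + j, -(3 * (j : ZMod m))] k) :=
  letter_of_isStandardQuadruple hα.1.1 hind (isStandardQuadruple_of_nine_dvd_odd hodd h9 hp hpm hbig hα hind hprim)

end NineDvdOdd

end Literature.AlgebraicGeometry.Shioda1982
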